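import Mathlib
import Literature.AlgebraicGeometry.Resolution.CobordantGame
import Literature.AlgebraicGeometry.Resolution.CobordantArcLemma
import Literature.AlgebraicGeometry.Resolution.CobordantVertexChart
import Literature.AlgebraicGeometry.Resolution.CobordantChartCoefficients
import Literature.AlgebraicGeometry.Resolution.FormalInverseFunction
import Summits.ResolutionOfSingularities.ResolutionOfSingularities.Theorems.WeightedInvariantLocalWeightedDropGradedSliceRank

/-!
# `WeightedInvariant.LocalWeightedDrop`: the FROBENIUS-LINE OBSTRUCTION of the graded game — `x_{i₁}^p + x_{i₂}^p` has no
# graded one-move win as soon as the characters of `x_{i₁}` and `x_{i₂}` differ (every dimension, every lattice)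

Route `ResolutionOfSingularities/WeightedInvariant`, crux `LocalWeightedDrop` (stmt-ResolutionOfSingularities-8899).
[OURS · L1 W4.3] — CHAIN w43 SEAT TABLE v7 row res-type-060 «idea-1's graded slices»; class-level form of the obstruction found
while probing R3-T3 `gradedWonBy_slice_iff` (companions: `…GradedSliceRank` p507692, `…GradedSliceNoOneMoveWin` p508918 — its
`not_gradedWonBy_zero_addPow` is the case `n = 3`, `(i₁, i₂) = (Z, y)`, with a superfluous second lattice hypothesis —,
`…GradedSliceRankOne` p509095).  A calibration theorem for the graded game `GradedGame.GradedWonBy` of the line (idea-1 Sketch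
v3/v4 §5): it says precisely how a WILD grading (characters with `p`-torsion quotient) obstructs the plain game's one-move wins.
Nothing here is a statement of the manuscript under review on ladder RESOLUTION; not a verdict on card A.  AI proof, weaker than
expert review.

* `not_gradedWonBy_zero_X_pow_add_X_pow` — for every field `k` of characteristic `p`, every `n`, every lattice `L ⊆ ℤⁿ` and
  indices with `e_{i₁} − e_{i₂} ∉ L` (the characters of `x_{i₁}`, `x_{i₂}` under `D(ℤⁿ/L)` DIFFER):
  `¬ GradedWonBy 0 n L (x_{i₁}^p + x_{i₂}^p)`.  In the PLAIN game this germ `= (x_{i₁} + x_{i₂})^p` is won in one move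
  (straighten `x_{i₁} + x_{i₂}` to a coordinate, blow up the divisor); the grading forbids the straightening, and the theorem says no
  other graded move wins either.  Proof: for an `L`-graded move `(θ, w)` the rows `i₁`, `i₂` of the linear part `A` of `θ` are
  non-zero (`A` is invertible) with DISJOINT supports (`A i j ≠ 0 ⇒ e_j − e_i ∈ L`), so the linear part `ℓ` of the smooth form
  `m := θ(x_{i₁}) + θ(x_{i₂})` has two distinct non-zero entries `ℓ_{j₁}`, `ℓ_{j₂}`; `θ(x_{i₁}^p + x_{i₂}^p) = m^p` (Frobenius).
  The coordinate system `Θ = (x_j)_{j ≠ j₁} ∪ (m)` has `det = ℓ_{j₁}` (Cramer on `updateRow 1 j₁ ℓ`) and a formal inverse `Ψ`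
  (`FormalCoordChange.exists_comp_inverse`); the arcs `t ↦ Ψ(v·t)` with `v_{j₁} = 0` lie on `{m = 0}`, kill every
  `∂(m^p) = p·m^{p−1}·∂m = 0`, and leave the centre `V(x_i : w_i > 0)` for `v = e_i` (`i ≠ j₁`) or `v = e_{j₂}` (`i = j₁`: then
  `ℓ_{j₁}·Γ_{j₁}'(0) = −ℓ_{j₂} ≠ 0`); the ARC LEMMA (`CobordantArc.exists_offVertex_singular_of_arc`) yields an exceptional point off
  the vertex whose `s`-saturated successor (`CobordantVertexChart.exists_eq_X_pow_mul_not_dvd`) is SINGULAR.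
* `not_gradedWonBy_zero_addPow'` — the `n = 3` slice case of `…GradedSliceNoOneMoveWin` with the single hypothesis
  `e_Z − e_y ∉ L`.
-/

set_option linter.dupNamespace false -- mandated namespace of this single-conjunct summit
set_option autoImplicit false

namespace Summit.ResolutionOfSingularities.ResolutionOfSingularities.Theorems

namespace GradedGame

open MvPowerSeries
open Literature.AlgebraicGeometry.Resolution
open Literature.AlgebraicGeometry.Resolution.CobordantChart (chart subst_chart_ne_zero)
open Literature.AlgebraicGeometry.Resolution.CobordantArc (exists_offVertex_singular_of_arc coeff_degree_one_subst
  linMat_mul_of_comp_eq_X constantCoeff_subst_arc_zero)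
open Literature.AlgebraicGeometry.Resolution.FormalCoordChange (linMat exists_comp_inverse)
open Literature.RingTheory.MvPowerSeries (pd pd_pow_succ)

variable {k : Type} [Field k]

section FrobeniusLine

variable (p : ℕ) [hp : Fact p.Prime]

/-- **THE FROBENIUS-LINE OBSTRUCTION (class level: every dimension, every grading lattice, every field of characteristic `p`).**
If the characters of the coordinates `x_{i₁}` and `x_{i₂}` DIFFER modulo `L` (`e_{i₁} − e_{i₂} ∉ L`), then the `L`-homogeneous germ
`x_{i₁}^p + x_{i₂}^p = (x_{i₁} + x_{i₂})^p` has NO graded one-move win: `¬ GradedWonBy 0 n L (X i₁ ^ p + X i₂ ^ p)`.  For an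
`L`-graded move `(θ, w)` the rows `i₁`, `i₂` of the linear part of `θ` are non-zero with DISJOINT supports (gradedness), so the
linear part `ℓ` of the smooth form `m := θ(x_{i₁}) + θ(x_{i₂})` has two non-zero entries `ℓ_{j₁}`, `ℓ_{j₂}`; `θ(x_{i₁}^p + x_{i₂}^p) = m^p`
(Frobenius); the coordinate system `(x_j)_{j ≠ j₁} ∪ (m)` (determinant `ℓ_{j₁}`, Cramer) has a formal inverse `Ψ`
(`FormalCoordChange.exists_comp_inverse`), the arcs `t ↦ Ψ(v t)` (`v_{j₁} = 0`) lie on `{m = 0}` and kill every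
`∂(m^p) = p·m^{p−1}∂m = 0`, and `v = e_{i}` (or `v = e_{j₂}` when the positive weight sits at `j₁`) makes the arc leave the centre
`V(x_i : w_i > 0)`; the ARC LEMMA (`CobordantArc.exists_offVertex_singular_of_arc`) then produces an exceptional point off the
vertex with SINGULAR `s`-saturated successor.  (Generalises `not_gradedWonBy_zero_addPow`, whose second lattice hypothesis is
superfluous.) [OURS · L1 W4.3] -/
theorem not_gradedWonBy_zero_X_pow_add_X_pow [CharP k p] {n : ℕ} (L : AddSubgroup (Fin n → ℤ)) (i₁ i₂ : Fin n)
    (h12 : (Pi.single i₁ 1 - Pi.single i₂ 1 : Fin n → ℤ) ∉ L) :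
    ¬ GradedWonBy 0 n L (X i₁ ^ p + X i₂ ^ p : MvPowerSeries (Fin n) k) := by
  classical
  have hp0 : 0 < p := hp.out.pos
  haveI : CharP (MvPowerSeries (Fin n) k) p := charP_of_injective_ringHom MvPowerSeries.C_injective p
  rw [gradedWonBy_zero_iff]
  rintro ⟨θ, w, ⟨⟨hθ0, hdet, hwpos⟩, hgr⟩, hno⟩
  have hθ : HasSubst θ := hasSubst_of_constantCoeff_zero hθ0
  set A : Matrix (Fin n) (Fin n) k := Matrix.of fun i j => coeff (Finsupp.single j 1) (θ i) with hA
  -- gradedness: `A i j ≠ 0 ⇒ e_j − e_i ∈ L`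
  have hmemL : ∀ i j : Fin n, A i j ≠ 0 → (Pi.single j 1 - Pi.single i 1 : Fin n → ℤ) ∈ L := by
    intro i j hne
    have hmem := hgr i (Finsupp.single j 1) hne
    rwa [expVec_single, Nat.cast_one] at hmem
  -- rows `i₁`, `i₂` of `A` have disjoint supports
  have hdisj : ∀ j, A i₁ j ≠ 0 → A i₂ j ≠ 0 → False := by
    intro j h1 h2
    apply h12
    have := L.sub_mem (hmemL i₂ j h2) (hmemL i₁ j h1)
    -- (e_j − e_{i₂}) − (e_j − e_{i₁}) = e_{i₁} − e_{i₂}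
    simpa using this
  -- every row of the invertible matrix `A` is non-zero
  have hrow : ∀ i, ∃ j, A i j ≠ 0 := by
    intro i
    by_contra hcon
    push Not at hcon
    have hz : A.det = 0 := Matrix.det_eq_zero_of_row_eq_zero i fun j => hcon j
    rw [hz] at hdet
    exact not_isUnit_zero hdet
  -- the smooth form `m` and its linear part `ℓ`
  set m : MvPowerSeries (Fin n) k := θ i₁ + θ i₂ with hm
  have hsub : subst θ (X i₁ ^ p + X i₂ ^ p : MvPowerSeries (Fin n) k) = m ^ p := by
    rw [subst_add hθ, subst_pow hθ, subst_pow hθ, subst_X hθ, subst_X hθ, hm, add_pow_char]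
  have hm0 : constantCoeff m = 0 := by rw [hm, map_add, hθ0, hθ0, add_zero]
  set ℓ : Fin n → k := fun j => coeff (Finsupp.single j 1) m with hℓ
  have hℓA : ∀ j, ℓ j = A i₁ j + A i₂ j := by intro j; simp [hℓ, hm, hA, map_add]
  obtain ⟨j₁, hj₁⟩ := hrow i₁
  obtain ⟨j₂, hj₂⟩ := hrow i₂
  have hA21 : A i₂ j₁ = 0 := by by_contra h; exact hdisj j₁ hj₁ h
  have hA12 : A i₁ j₂ = 0 := by by_contra h; exact hdisj j₂ h hj₂
  have hℓ1 : ℓ j₁ ≠ 0 := by rw [hℓA, hA21, add_zero]; exact hj₁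
  have hℓ2 : ℓ j₂ ≠ 0 := by rw [hℓA, hA12, zero_add]; exact hj₂
  have hj12 : j₁ ≠ j₂ := by rintro rfl; exact hdisj j₁ hj₁ hj₂
  have hmne : m ≠ 0 := fun h => hℓ1 (by simp [hℓ, h])
  -- the coordinate system `Θ = (x_j)_{j ≠ j₁} ∪ (m at slot j₁)` and its formal inverse `Ψ`
  set Θ : Fin n → MvPowerSeries (Fin n) k := Function.update (fun i => X i) j₁ m with hΘ
  have hΘj : Θ j₁ = m := by simp [hΘ]
  have hΘi : ∀ i, i ≠ j₁ → Θ i = X i := by intro i hi; simp [hΘ, hi]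
  have hΘ0 : ∀ i, constantCoeff (Θ i) = 0 := by
    intro i
    by_cases hi : i = j₁
    · rw [hi, hΘj]; exact hm0
    · rw [hΘi i hi]; exact constantCoeff_X i
  have hlinΘ : linMat Θ = Matrix.updateRow (1 : Matrix (Fin n) (Fin n) k) j₁ ℓ := by
    ext i j
    show coeff (Finsupp.single j 1) (Θ i) = _
    by_cases hi : i = j₁
    · subst hi
      rw [hΘj, Matrix.updateRow_self]
    · rw [hΘi i hi, Matrix.updateRow_ne hi, coeff_X, Matrix.one_apply]
      by_cases hij : i = j
      · subst hij; simp
      · rw [if_neg (fun hh => hij ((Finsupp.single_left_inj one_ne_zero).mp hh).symm), if_neg hij]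
  have hdetΘ : (linMat Θ).det = ℓ j₁ := by
    rw [hlinΘ, ← Matrix.det_transpose, ← Matrix.updateCol_transpose, Matrix.transpose_one, ← Matrix.cramer_apply,
      Matrix.cramer_one]
    rfl
  have hΘdet : IsUnit (linMat Θ).det := by rw [hdetΘ]; exact isUnit_iff_ne_zero.mpr hℓ1
  obtain ⟨Ψ, hΨ0, hΨΘ, -⟩ := exists_comp_inverse hΘ0 hΘdet
  have hΨ : HasSubst Ψ := hasSubst_of_constantCoeff_zero hΨ0
  have hΨX : ∀ i, i ≠ j₁ → Ψ i = X i := by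
    intro i hi
    have h := hΨΘ i
    rwa [hΘi i hi, subst_X hΨ] at h
  have hΨm : subst Ψ m = X j₁ := by rw [← hΘj]; exact hΨΘ j₁
  -- the linear part `B` of `Ψ`; row `j₁` of `linMat Θ · B = 1`
  set B : Matrix (Fin n) (Fin n) k := Matrix.of fun i j => coeff (Finsupp.single j 1) (Ψ i) with hB
  have hΘB : linMat Θ * B = 1 := linMat_mul_of_comp_eq_X hΨ0 hΨΘ
  have hBX : ∀ l, l ≠ j₁ → ∀ j, B l j = if l = j then 1 else 0 := by
    intro l hl j
    show coeff (Finsupp.single j 1) (Ψ l) = _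
    rw [hΨX l hl, coeff_X]
    by_cases hlj : l = j
    · subst hlj; simp
    · rw [if_neg (fun hh => hlj ((Finsupp.single_left_inj one_ne_zero).mp hh).symm), if_neg hlj]
  have hrowB : ∀ j, j ≠ j₁ → ℓ j₁ * B j₁ j = -ℓ j := by
    intro j hj
    have h := congrFun (congrFun hΘB j₁) j
    rw [Matrix.mul_apply, Matrix.one_apply, if_neg (Ne.symm hj), hlinΘ] at h
    simp only [Matrix.updateRow_self] at h
    rw [← Finset.add_sum_erase Finset.univ _ (Finset.mem_univ j₁)] at h
    have hrest : ∑ l ∈ Finset.univ.erase j₁, ℓ l * B l j = ℓ j := by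
      rw [Finset.sum_congr rfl (g := fun l => if l = j then ℓ l else 0)]
      · rw [Finset.sum_ite_eq', if_pos (Finset.mem_erase.mpr ⟨hj, Finset.mem_univ j⟩)]
      · intro l hl
        rw [hBX l (Finset.ne_of_mem_erase hl)]
        split_ifs <;> simp
    rw [hrest] at h
    linear_combination h
  -- the arcs `t ↦ Ψ(v t)` with `v_{j₁} = 0` lie on `{m = 0}`
  have hcX : ∀ a : k, MvPowerSeries.coeff (Finsupp.single () 1) (a • PowerSeries.X : PowerSeries k) = a := by
    intro a
    show MvPowerSeries.coeff (Finsupp.single () 1) (a • (MvPowerSeries.X () : MvPowerSeries Unit k)) = a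
    rw [map_smul, MvPowerSeries.coeff_X, if_pos rfl, smul_eq_mul, mul_one]
  have harc : ∀ v : Fin n → k, v j₁ = 0 → ∃ Γ : Fin n → PowerSeries k, (∀ i, PowerSeries.constantCoeff (Γ i) = 0) ∧
      (∀ i, i ≠ j₁ → Γ i = v i • PowerSeries.X) ∧
      ℓ j₁ * MvPowerSeries.coeff (Finsupp.single () 1) (Γ j₁) = -∑ l, ℓ l * v l ∧
      (MvPowerSeries.subst Γ m : PowerSeries k) = 0 ∧
      ∀ J, (MvPowerSeries.subst Γ (pd J (m ^ p)) : PowerSeries k) = 0 := by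
    intro v hv
    let γ : Fin n → PowerSeries k := fun i => v i • PowerSeries.X
    have hγ0 : ∀ i, PowerSeries.constantCoeff (γ i) = 0 := by intro i; simp [γ]
    have hγs : HasSubst γ := hasSubst_of_constantCoeff_zero hγ0
    have hΓ0 : ∀ i, PowerSeries.constantCoeff (MvPowerSeries.subst γ (Ψ i) : PowerSeries k) = 0 :=
      constantCoeff_subst_arc_zero hΨ0 γ hγ0
    have hΓs : HasSubst (fun i => (MvPowerSeries.subst γ (Ψ i) : PowerSeries k)) := hasSubst_of_constantCoeff_zero hΓ0
    refine ⟨fun i => MvPowerSeries.subst γ (Ψ i), hΓ0, ?_, ?_, ?_, ?_⟩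
    · intro i hi
      show MvPowerSeries.subst γ (Ψ i) = _
      rw [hΨX i hi, subst_X hγs]
    · show ℓ j₁ * MvPowerSeries.coeff (Finsupp.single () 1) (MvPowerSeries.subst γ (Ψ j₁)) = _
      rw [coeff_degree_one_subst γ hγ0 (Ψ j₁) (Finsupp.single () 1) (by simp)]
      have hterm : ∀ l, coeff (Finsupp.single l 1) (Ψ j₁) * MvPowerSeries.coeff (Finsupp.single () 1) (γ l) = B j₁ l * v l := by
        intro l
        show _ = coeff (Finsupp.single l 1) (Ψ j₁) * v l
        rw [hcX]
      simp only [hterm]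
      rw [Finset.mul_sum, ← Finset.sum_neg_distrib]
      refine Finset.sum_congr rfl fun l _ => ?_
      by_cases hl : l = j₁
      · rw [hl, hv, mul_zero, mul_zero, neg_zero]
      · rw [← mul_assoc, hrowB l hl, neg_mul]
    · rw [← subst_comp_subst_apply hΨ hγs, hΨm, subst_X hγs]
      show v j₁ • PowerSeries.X = 0
      rw [hv, zero_smul]
    · intro J
      have hpd0 : pd J (m ^ p) = 0 := by
        obtain ⟨q, hq⟩ : ∃ q, p = q + 1 := ⟨p - 1, (Nat.sub_add_cancel hp.out.one_le).symm⟩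
        rw [hq, pd_pow_succ, ← hq, CharP.cast_eq_zero, zero_mul, zero_mul]
      rw [hpd0, ← coe_substAlgHom hΓs, map_zero]
  -- choose the direction `v` so that the arc leaves the centre `V(xᵢ : wᵢ > 0)`
  obtain ⟨i, hi⟩ := hwpos
  have hchoice : ∃ v : Fin n → k, v j₁ = 0 ∧ ∀ Γ : Fin n → PowerSeries k, (∀ i', i' ≠ j₁ → Γ i' = v i' • PowerSeries.X) →
      ℓ j₁ * MvPowerSeries.coeff (Finsupp.single () 1) (Γ j₁) = -∑ l, ℓ l * v l → Γ i ≠ 0 := by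
    by_cases hij : i = j₁
    · -- leave through the `j₁`-coordinate itself: direction `e_{j₂}`
      refine ⟨Pi.single j₂ 1, by simp [hj12], fun Γ _ hΓ hz => hℓ2 ?_⟩
      rw [hij] at hz
      rw [hz, map_zero, mul_zero] at hΓ
      have hsum : ∑ l, ℓ l * (Pi.single j₂ (1 : k) : Fin n → k) l = ℓ j₂ := by
        rw [Finset.sum_eq_single j₂]
        · simp
        · intro l _ hl; simp [hl]
        · intro h; exact absurd (Finset.mem_univ j₂) h
      rw [hsum] at hΓ
      linear_combination hΓ
    · refine ⟨Pi.single i 1, by simp [Ne.symm hij], fun Γ hΓ _ => ?_⟩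
      rw [hΓ i hij, Pi.single_eq_same, one_smul]
      exact PowerSeries.X_ne_zero
  obtain ⟨v, hv, hvΓ⟩ := hchoice
  obtain ⟨Γ, hΓ0, hΓX, hΓj, hΓm, hΓpd⟩ := harc v hv
  have hΓs : HasSubst Γ := hasSubst_of_constantCoeff_zero hΓ0
  have hS : ∃ i, 0 < w i ∧ Γ i ≠ 0 := ⟨i, hi, hvΓ Γ hΓX hΓj⟩
  have hf : (MvPowerSeries.subst Γ (m ^ p) : PowerSeries k) = 0 := by
    rw [subst_pow hΓs, hΓm, zero_pow hp0.ne']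
  obtain ⟨c', hc'conv, hoff, hall⟩ := exists_offVertex_singular_of_arc w (m ^ p) Γ hΓ0 hS hf hΓpd
  have hF : MvPowerSeries.subst (chart w c') (m ^ p) ≠ 0 := subst_chart_ne_zero w c' hc'conv (pow_ne_zero _ hmne)
  obtain ⟨a', g', hfac, hndvd⟩ := CobordantVertexChart.exists_eq_X_pow_mul_not_dvd hF
  refine hno c' a' g' ⟨hoff, ?_, hndvd, hall a' g' hfac⟩
  rw [hsub, cruxChart_eq_chart_of_convention w c' hc'conv]
  exact hfac

/-- The slice case of `WeightedInvariantLocalWeightedDropGradedSliceNoOneMoveWin.not_gradedWonBy_zero_addPow` with its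
superfluous hypothesis removed: on `k[[s, Z, y]]`, `Z^p + y^p` has no graded one-move win as soon as the characters of `Z` and
`y` differ. [OURS · L1 W4.3] -/
theorem not_gradedWonBy_zero_addPow' [CharP k p] (L : AddSubgroup (Fin 3 → ℤ))
    (h12 : (Pi.single 1 1 - Pi.single 2 1 : Fin 3 → ℤ) ∉ L) :
    ¬ GradedWonBy 0 3 L (X 1 ^ p + X 2 ^ p : MvPowerSeries (Fin 3) k) :=
  not_gradedWonBy_zero_X_pow_add_X_pow p L 1 2 h12

end FrobeniusLine

end GradedGame

end Summit.ResolutionOfSingularities.ResolutionOfSingularities.Theorems
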